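import Literature.Geometry.Riemannian.ThreeShrinkerFlatCase
import Literature.Geometry.Riemannian.ThreeShrinkerClassificationProofs
import HarnessLib

/-!
# The flat case of `threeShrinkerClassification_modelData`: disjunct (o) verbatim

Sequel to `ThreeShrinkerFlatCase.lean` (a complete connected flat normalised three-dimensional
gradient shrinker is isometric to `(ℝ³, δ)` with `φ = |x − a|²/4`, and
`∫_N e^{-φ} dV_h = ∫_{ℝ³} e^{-|y−a|²/4} dV_δ`, `modelData_o_of_isFlat_gaussianIntegral`) and
`ThreeShrinkerClassificationProofs.lean` (`dV_δ = dx`, `ThreeShrinker.riemannianMeasure_euclideanMetric`;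
`∫_{ℝ³} e^{-|y−a|²/4} dy = 8π√π`, `ThreeShrinker.lintegral_exp_neg_norm_sub_sq_div_four`): the two
are assembled into disjunct (o) of the named fact
`Literature.Geometry.Riemannian.threeShrinkerClassification_modelData` (Munteanu–Wang
arXiv:1606.01861, Thm. 1.2; Cao–Chen–Zhu, Lemma 4.6: the Gaussian soliton `ℝ³`) for every flat
member of its binder, and into the fact's full four-way disjunction in that case
(`modelData_of_isFlat`). Everything is proved; no definitions, no named facts (D-0026).

## References

* O. Munteanu, J. Wang, *Structure at infinity for shrinking Ricci solitons*, arXiv:1606.01861,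
  Thm. 1.2 (p. 3). [MunteanuWang2016]
* H.-D. Cao, B.-L. Chen, X.-P. Zhu, Surveys in Differential Geometry XII (2008), Lemma 4.6 and
  Prop. 4.7 (pp. 77–78). [CaoChenZhu2007]
* H.-D. Cao, R. S. Hamilton, T. Ilmanen, arXiv:math/0404165 (2004), §3. [CaoHamiltonIlmanen2004]
-/

noncomputable section

open Bundle Set Function Filter Module MeasureTheory
open scoped Manifold ContDiff Topology ENNReal NNReal

namespace Literature.Geometry.Riemannian

open Lorentzian Lorentzian.PseudoRiemannianMetric

namespace ThreeShrinker

variable (N : Type*) [TopologicalSpace N] [T2Space N]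
  [ChartedSpace (EuclideanSpace ℝ (Fin 3)) N] [IsManifold (𝓡 3) ∞ N] [ConnectedSpace N]
  [T3Space N] [MeasurableSpace N] [BorelSpace N]
  (h : PseudoRiemannianMetric (𝓡 3) ∞ (EuclideanSpace ℝ (Fin 3))
    (TangentSpace (𝓡 3) : N → Type _)) [h.HasLeviCivita]
  (φ : N → ℝ) (hh : h.IsRiemannian)

/-- **Disjunct (o) of `threeShrinkerClassification_modelData` in the flat case.** For a complete
connected flat normalised gradient shrinker `(N³, h, φ)` (the fact's binder plus
`h.leviCivita.IsFlat`): `R ≡ 0` and `∫_N e^{-φ} dV_h = 8π√π = (4π)^{3/2}`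
(`modelData_o_of_isFlat_gaussianIntegral`, `riemannianMeasure_euclideanMetric`,
`lintegral_exp_neg_norm_sub_sq_div_four`). Derivation (o) of the fact's docstring, including the
exclusion of the flat space forms `ℝ³/Γ`, `Γ ≠ 1`.
[cite: MunteanuWang2016, Thm 1.2 (p. 3)] [cite: CaoChenZhu2007, Lemma 4.6 (p. 77)]
[cite: CaoHamiltonIlmanen2004, §3] -/
theorem modelData_o_of_isFlat
    (hcpl : ∀ (x : N) (r : ℝ≥0), IsCompact {y : N | h.edist hh x y ≤ r})
    (hφ : ContMDiff (𝓡 3) 𝓘(ℝ, ℝ) ∞ φ)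
    (hsol : ∀ (x : N) (X Y : TangentSpace (𝓡 3) x),
      h.ricci x X Y + h.hessian φ x X Y = (1 / 2 : ℝ) * h.val x X Y)
    (hnorm : ∀ x : N, h.scalarCurvature x + h.gradSq φ x = φ x)
    (hflat : h.leviCivita.IsFlat) :
    (∀ x : N, h.scalarCurvature x = 0) ∧
      ∫⁻ x, ENNReal.ofReal (Real.exp (-φ x))
          ∂(riemannianMeasure (h.toContMDiffRiemannianMetric hh)) =
        ENNReal.ofReal (8 * Real.pi * Real.sqrt Real.pi) := by
  obtain ⟨hR, a, hint⟩ :=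
    modelData_o_of_isFlat_gaussianIntegral N h φ hh hcpl hφ hsol hnorm hflat
  refine ⟨hR, ?_⟩
  rw [hint, riemannianMeasure_euclideanMetric, lintegral_exp_neg_norm_sub_sq_div_four]

/-- **The conclusion of `threeShrinkerClassification_modelData` for flat members of its binder**
(its four-way disjunction, by the first disjunct). What remains for the fact itself is the
classification input routing every complete three-dimensional shrinker either to this case, to
the compact space forms (Ivey), or to the cylinder quotients (Perelman; Ni–Wallach;
Cao–Chen–Zhu, Prop. 4.7). [cite: MunteanuWang2016, Thm 1.2 (p. 3)]
[cite: CaoChenZhu2007, Prop 4.7 (p. 78) and Lemma 4.6 (p. 77)] -/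
theorem modelData_of_isFlat
    (hcpl : ∀ (x : N) (r : ℝ≥0), IsCompact {y : N | h.edist hh x y ≤ r})
    (hφ : ContMDiff (𝓡 3) 𝓘(ℝ, ℝ) ∞ φ)
    (hsol : ∀ (x : N) (X Y : TangentSpace (𝓡 3) x),
      h.ricci x X Y + h.hessian φ x X Y = (1 / 2 : ℝ) * h.val x X Y)
    (hnorm : ∀ x : N, h.scalarCurvature x + h.gradSq φ x = φ x)
    (hflat : h.leviCivita.IsFlat) :
    ((∀ x : N, h.scalarCurvature x = 0) ∧
        ∫⁻ x, ENNReal.ofReal (Real.exp (-φ x))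
            ∂(riemannianMeasure (h.toContMDiffRiemannianMetric hh)) =
          ENNReal.ofReal (8 * Real.pi * Real.sqrt Real.pi)) ∨
    (CompactSpace N ∧ (∀ x : N, h.scalarCurvature x = 3 / 2) ∧ (∀ x : N, φ x = 3 / 2) ∧
        ∃ k : ℕ, 0 < k ∧
          riemannianMeasure (h.toContMDiffRiemannianMetric hh) Set.univ =
            ENNReal.ofReal (16 * Real.pi ^ 2 / k)) ∨
    ((∀ x : N, h.scalarCurvature x = 1) ∧
        ∫⁻ x, ENNReal.ofReal (Real.exp (-φ x))
            ∂(riemannianMeasure (h.toContMDiffRiemannianMetric hh)) =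
          ENNReal.ofReal (16 * Real.pi * Real.sqrt Real.pi * Real.exp (-1))) ∨
    ((∀ x : N, h.scalarCurvature x = 1) ∧
        ∫⁻ x, ENNReal.ofReal (Real.exp (-φ x))
            ∂(riemannianMeasure (h.toContMDiffRiemannianMetric hh)) =
          ENNReal.ofReal (8 * Real.pi * Real.sqrt Real.pi * Real.exp (-1))) :=
  Or.inl (modelData_o_of_isFlat N h φ hh hcpl hφ hsol hnorm hflat)

end ThreeShrinker

end Literature.Geometry.Riemannian

end
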